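import Summits.Ventures.LatticeQCDFlow.Scoring.FreeFieldHeatBath
import Summits.Ventures.LatticeQCDFlow.Scoring.SchwingerDysonPlaneWaves
import Summits.Ventures.LatticeQCDFlow.Scoring.CalibrationTruths
import HarnessLib

/-!
# Heat bath on the free field, II: plane waves diagonalise the random scan; `τ_int` in closed form; `z = 2` exactly

HONEST FRAMING: exact (Metropolis-corrected) sampling algorithms for lattice gauge theory;
figures of merit are autocorrelation/cost numbers at stated couplings and volumes; no
continuum-physics claim.  (SCALAR calibration rung S0-A: not a gauge result.)

Venture `LatticeQCDFlow` (cell pub-lqcd), sub-topic `Scoring`; FANOUT row 2 (`s0-phi4`).  NEW WORK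
of the cell (finite sums over the Schwinger–Dyson files of the same row); nothing is cited as a
fact.  Printed counterparts, named only: Goodman–Sokal 1989 (Phys. Rev. D 40, 2035: critical
slowing down `τ ∝ ξ²` of local stochastic relaxation on the Gaussian model), Adler 1981,
Fox–Parker 2017, Kazashi–Müller–Scheichl 2024 (arXiv:2407.12149 §3.1 eq. (3.2): the Gibbs sampler
acts mode by mode on the eigenvectors of the precision matrix).

## What is proved

For the engine's free field `J = shiftCoupling σ m²` (`−Δ_lat + m²` generated by shift bijections
`σ_μ`, `μ : ι`, on `V = n + 1` sites, no shift fixing a site so `J_{xx} = 2d + m²`, `d = |ι|`;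
`Scoring/SchwingerDysonPhi4Lattice.lean`) and the random-scan `ω`-heat bath `scanUpdate` of
`Scoring/FreeFieldHeatBath.lean`:

* `scanFactor d V m² κ ω = 1 − ω(κ + m²)/(V(2d + m²))`;
* **`scanUpdate_eigenmode`** — every eigenmode `b` of `−Δ_lat` with eigenvalue `κ`
  (`Σ_μ (2b_x − b(σ_μx) − b(σ_μ⁻¹x)) = κ b_x`: the plane waves `cos/sin(k·x)` with
  `κ = k̂² = Σ_μ 4 sin²(k_μ/2)` of `Scoring/SchwingerDysonPlaneWaves.lean`; the constant mode,
  `κ = 0`, `const_eigenmode`) yields a linear observable `O_b = Σ_y b_y φ_y` that is an EXACT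
  EIGENFUNCTION of the scan operator: `P^ω O_b = scanFactor · O_b`, for every `ω` and every real
  `m²` with `2d + m² ≠ 0` (summation by parts `sum_mul_force_shift_of_eigen`);
  `scanUpdate_eigenmode_iterate`: `(P^ω)^t O_b = scanFactor^t · O_b`;
  `scanUpdate_magnetisation` (`M = Σ_x φ_x`, factor `1 − ωm²/(V(2d + m²))`).
* **In the Gibbs law** `e^{−S}/Z` (`m² > 0`; `gibbsExpect` of `Scoring/SchwingerDysonPhi4Gibbs.lean`):
  `free_mode_mean` `⟨O_b⟩ = 0` (`κ + m² ≠ 0`); **`free_mode_autocov`**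
  `⟨((P^ω)^t O_b)·O_b⟩ = scanFactor^t · ‖b‖²/(2(κ + m²))` (the oracle `free_spectral_oracle_div`);
  **`free_mode_acf`** `⟨((P^ω)^t O_b) O_b⟩ / ⟨O_b²⟩ = scanFactor^t`.  By the Markov property the
  left side is `E[O_b(φ_t) O_b(φ₀)]` for the chain started from `φ₀ ∼ e^{−S}/Z`, so every Fourier
  mode of the free-field heat-bath chain is an AR(1) series with KNOWN coefficient — a field-valued
  member of the scorers' calibration family C-1 (`Scoring/CalibrationTruths.lean`).
* **τ_int in closed form** (`tauInt`, Madras–Sokal convention, `tauInt_geometric`):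
  `tauInt_scanFactor_div` — `τ_int(O_κ)/V = (2d + m²)/(ω(κ + m²)) − 1/(2V)` SWEEPS of `V` updates,
  whenever `0 < ω(κ + m²) < 2V(2d + m²)`; `tauInt_heatBath_mode` — `ω = 1`, every `0 ≤ κ ≤ 4d`
  (the whole spectrum of `−Δ_lat`), `m² > 0`;
  **`tauInt_heatBath_magnetisation`: `τ_int(M)/V = 2d·(1/m²) + 1 − 1/(2V)`.**  With the free
  field's second-moment correlation length `ξ₂² = 1/m²` (`xi2_free`, read off the battery's oracle
  `G̃(k) = 1/(2(m² + k̂²))`): `τ_int,sweeps(M) = 2d·ξ₂² + 1 − 1/(2V)` at EVERY volume — the dynamical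
  exponent of the local heat bath is `z = 2` EXACTLY, amplitude `2d`, with the stated `O(1)` and
  `O(1/V)` terms and nothing else; `tauInt_overrelaxed_magnetisation`: a fixed `ω ∈ (0, 2)` divides
  the leading term by `ω` and leaves `z = 2` (random site order; Adler–Neuberger's `z → 1` needs the
  ORDERED sweep with `2 − ω ∝ m`, not treated).

Use (row 2): the free-field baseline against which S0-A's fitted local-update exponents
(`z ≈ 2` for local Metropolis on `χ₂`, `|M|`) are read, and an end-to-end closed-form test series
for a τ_int estimator on lattice data at any `(m², L, d)`.  NOT CLAIMED: the ordered sweep (its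
linear part is Gauss–Seidel proper, another spectrum); Metropolis ≠ heat bath; `λ > 0`;
statistical power (numerics gate).
-/

namespace Summit.Ventures.LatticeQCDFlow.Scoring

open Real MeasureTheory ProbabilityTheory Finset Filter

/-! ## The engine's free field: plane waves are eigenfunctions of the scan operator -/

section Shift

variable {n : ℕ} {ι : Type*} [Fintype ι]

/-- The per-update factor of the mode with `−Δ_lat`-eigenvalue `κ` under the random-scan
`ω`-heat bath of the free field on `V` sites in `d` directions:
`1 − ω (κ + m²) / (V (2d + m²))`. -/
noncomputable def scanFactor (d V : ℕ) (m2 κ ω : ℝ) : ℝ :=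
  1 - ω * (κ + m2) / (V * (2 * d + m2))

/-- **Plane waves are exact eigenfunctions of the random-scan heat bath.**  For the engine's
free action (`J = −Δ_lat + m²`, shifts fixing no site, `2d + m² ≠ 0`), every `ω`, and every
eigenmode `b` of `−Δ_lat` with eigenvalue `κ`, the linear observable `O_b = Σ_y b_y φ_y` satisfies
`P^ω O_b = (1 − ω(κ + m²)/(V(2d + m²))) · O_b` exactly, `V = n + 1`, `d = |ι|`. -/
theorem scanUpdate_eigenmode (σ : ι → Equiv.Perm (Fin (n + 1))) (m2 ω : ℝ)
    (hσ : ∀ μ x, σ μ x ≠ x) (hD : 2 * (Fintype.card ι : ℝ) + m2 ≠ 0)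
    {b : Fin (n + 1) → ℝ} {κ : ℝ}
    (hb : ∀ x, ∑ μ, (2 * b x - b (σ μ x) - b ((σ μ).symm x)) = κ * b x)
    (φ : Fin (n + 1) → ℝ) :
    scanUpdate (shiftCoupling σ m2) ω (fun ψ => ∑ y, b y * ψ y) φ
      = scanFactor (Fintype.card ι) (n + 1) m2 κ ω * ∑ y, b y * φ y := by
  rw [scanUpdate_linear]
  have hdiag : ∀ x, shiftCoupling σ m2 x x = 2 * Fintype.card ι + m2 :=
    fun x => shiftCoupling_diag σ m2 x (fun μ => hσ μ x)
  simp only [hdiag]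
  have hsum : ∑ x, b x * (latticePhi4Force (shiftCoupling σ m2) 0 φ x / (2 * (2 * Fintype.card ι + m2)))
      = (κ + m2) / (2 * Fintype.card ι + m2) * ∑ y, b y * φ y := by
    have e : ∑ x, b x * (latticePhi4Force (shiftCoupling σ m2) 0 φ x / (2 * (2 * Fintype.card ι + m2)))
        = (∑ x, b x * latticePhi4Force (shiftCoupling σ m2) 0 φ x)
          / (2 * (2 * Fintype.card ι + m2)) := by
      rw [Finset.sum_div]
      exact Finset.sum_congr rfl fun x _ => by ring
    rw [e, sum_mul_force_shift_of_eigen σ m2 0 hb φ]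
    field_simp
    ring
  rw [hsum, scanFactor, Fintype.card_fin]
  push_cast
  field_simp

/-- **Iterates**: `(P^ω)^t O_b = (scanFactor)^t · O_b` — the mode relaxes geometrically, update
by update. -/
theorem scanUpdate_eigenmode_iterate (σ : ι → Equiv.Perm (Fin (n + 1))) (m2 ω : ℝ)
    (hσ : ∀ μ x, σ μ x ≠ x) (hD : 2 * (Fintype.card ι : ℝ) + m2 ≠ 0)
    {b : Fin (n + 1) → ℝ} {κ : ℝ}
    (hb : ∀ x, ∑ μ, (2 * b x - b (σ μ x) - b ((σ μ).symm x)) = κ * b x) (t : ℕ) :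
    (scanUpdate (shiftCoupling σ m2) ω)^[t] (fun ψ => ∑ y, b y * ψ y)
      = fun φ => scanFactor (Fintype.card ι) (n + 1) m2 κ ω ^ t * ∑ y, b y * φ y := by
  induction t with
  | zero =>
      funext φ
      simp
  | succ t ih =>
      funext φ
      rw [Function.iterate_succ_apply', ih, scanUpdate_const_mul,
        scanUpdate_eigenmode σ m2 ω hσ hD hb φ]
      ring

/-- The constant vector is an eigenmode with `κ = 0` (the magnetisation `M = Σ_x φ_x`). -/
theorem const_eigenmode : ∑ _μ : ι, (2 * (1 : ℝ) - 1 - 1) = 0 * (1 : ℝ) := by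
  norm_num

/-- **The magnetisation relaxes by `1 − ω m²/(V(2d + m²))` per update.** -/
theorem scanUpdate_magnetisation (σ : ι → Equiv.Perm (Fin (n + 1))) (m2 ω : ℝ)
    (hσ : ∀ μ x, σ μ x ≠ x) (hD : 2 * (Fintype.card ι : ℝ) + m2 ≠ 0) (φ : Fin (n + 1) → ℝ) :
    scanUpdate (shiftCoupling σ m2) ω (fun ψ => ∑ y, ψ y) φ
      = scanFactor (Fintype.card ι) (n + 1) m2 0 ω * ∑ y, φ y := by
  have h := scanUpdate_eigenmode σ m2 ω hσ hD (b := fun _ => (1 : ℝ)) (κ := 0)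
    (fun _ => const_eigenmode (ι := ι)) φ
  simpa using h

/-! ## Stationary autocorrelations of the free-field chain -/

/-- `2d + m² > 0` for `m² > 0`. -/
theorem two_card_add_pos {m2 : ℝ} (hm2 : 0 < m2) : 0 < 2 * (Fintype.card ι : ℝ) + m2 := by
  positivity

/-- **Mean zero**: `⟨O_b⟩ = 0` for every eigenmode with `κ + m² ≠ 0` (free field, `m² > 0`). -/
theorem free_mode_mean (σ : ι → Equiv.Perm (Fin (n + 1))) {m2 : ℝ} (hm2 : 0 < m2)
    {b : Fin (n + 1) → ℝ} {κ : ℝ}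
    (hb : ∀ x, ∑ μ, (2 * b x - b (σ μ x) - b ((σ μ).symm x)) = κ * b x) (hκ : κ + m2 ≠ 0) :
    gibbsExpect (shiftCoupling σ m2) 0 (fun φ => ∑ y, b y * φ y) = 0 := by
  have hS := shiftCoupling_coercive_of_pos_mass σ (m2 := m2) le_rfl
  have hI : ∀ x, Integrable (fun φ : Fin (n + 1) → ℝ =>
      latticePhi4Force (shiftCoupling σ m2) 0 φ x * gibbsWeight (shiftCoupling σ m2) 0 φ) := by
    intro x
    refine (integrable_pow_mul_pow_mul_force_mul_gibbsWeight_of_coercive hm2 hS x x x 0 0).congr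
      (Eventually.of_forall fun φ => ?_)
    simp only [pow_zero, one_mul]
  have h1 : gibbsExpect (shiftCoupling σ m2) 0
      (fun φ => ∑ x, b x * latticePhi4Force (shiftCoupling σ m2) 0 φ x) = 0 := by
    rw [gibbsExpect_sum (shiftCoupling σ m2) 0 Finset.univ
      (fun x _ => ((hI x).const_mul (b x)).congr (Eventually.of_forall fun φ => by
        dsimp only; ring))]
    simp only [gibbsExpect_const_mul, gibbs_eom_of_coercive hm2 hS, mul_zero,
      Finset.sum_const_zero]
  have h2 : (fun φ : Fin (n + 1) → ℝ => ∑ x, b x * latticePhi4Force (shiftCoupling σ m2) 0 φ x)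
      = fun φ => (2 * (κ + m2)) * ∑ y, b y * φ y := by
    funext φ
    rw [sum_mul_force_shift_of_eigen σ m2 0 hb φ]
    ring
  rw [h2, gibbsExpect_const_mul] at h1
  rcases mul_eq_zero.mp h1 with h | h
  · exfalso
    exact hκ (by linarith)
  · exact h

/-- **The lag-`t` autocovariance in closed form.**  With `φ₀ ∼ e^{−S}/Z` (the free field,
`m² > 0`) and `φ_t` the random-scan `ω`-heat-bath chain, the Markov property gives
`E[O_b(φ_t) O_b(φ₀)] = ⟨((P^ω)^t O_b) · O_b⟩`, and this equals
`scanFactor^t · ‖b‖² / (2(κ + m²))`. -/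
theorem free_mode_autocov (σ : ι → Equiv.Perm (Fin (n + 1))) {m2 : ℝ} (hm2 : 0 < m2) (ω : ℝ)
    (hσ : ∀ μ x, σ μ x ≠ x) {b : Fin (n + 1) → ℝ} {κ : ℝ}
    (hb : ∀ x, ∑ μ, (2 * b x - b (σ μ x) - b ((σ μ).symm x)) = κ * b x) (hb0 : ∃ x, b x ≠ 0)
    (t : ℕ) :
    gibbsExpect (shiftCoupling σ m2) 0
        (fun φ => (scanUpdate (shiftCoupling σ m2) ω)^[t] (fun ψ => ∑ y, b y * ψ y) φ
          * ∑ y, b y * φ y)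
      = scanFactor (Fintype.card ι) (n + 1) m2 κ ω ^ t * ((∑ x, b x ^ 2) / (2 * (κ + m2))) := by
  rw [scanUpdate_eigenmode_iterate σ m2 ω hσ (two_card_add_pos hm2).ne' hb t]
  have e : (fun φ : Fin (n + 1) → ℝ =>
      (scanFactor (Fintype.card ι) (n + 1) m2 κ ω ^ t * ∑ y, b y * φ y) * ∑ y, b y * φ y)
      = fun φ => scanFactor (Fintype.card ι) (n + 1) m2 κ ω ^ t * (∑ y, b y * φ y) ^ 2 := by
    funext φ
    ring
  rw [e, gibbsExpect_const_mul, free_spectral_oracle_div σ hm2 hb hb0]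

/-- **The normalised autocorrelation function is geometric**: `ρ_t = ⟨((P^ω)^t O_b) O_b⟩ / ⟨O_b²⟩
= scanFactor^t` (the mean vanishes by `free_mode_mean`; `⟨O_b²⟩ ≠ 0` follows from the oracle). -/
theorem free_mode_acf (σ : ι → Equiv.Perm (Fin (n + 1))) {m2 : ℝ} (hm2 : 0 < m2) (ω : ℝ)
    (hσ : ∀ μ x, σ μ x ≠ x) {b : Fin (n + 1) → ℝ} {κ : ℝ}
    (hb : ∀ x, ∑ μ, (2 * b x - b (σ μ x) - b ((σ μ).symm x)) = κ * b x) (hb0 : ∃ x, b x ≠ 0)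
    (t : ℕ) :
    gibbsExpect (shiftCoupling σ m2) 0
        (fun φ => (scanUpdate (shiftCoupling σ m2) ω)^[t] (fun ψ => ∑ y, b y * ψ y) φ
          * ∑ y, b y * φ y)
        / gibbsExpect (shiftCoupling σ m2) 0 (fun φ => (∑ y, b y * φ y) ^ 2)
      = scanFactor (Fintype.card ι) (n + 1) m2 κ ω ^ t := by
  rw [free_mode_autocov σ hm2 ω hσ hb hb0 t, free_spectral_oracle_div σ hm2 hb hb0]
  have h := free_spectral_oracle σ hm2 hb
  obtain ⟨x0, hx0⟩ := hb0
  have hpos : 0 < ∑ x, b x ^ 2 :=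
    lt_of_lt_of_le (by positivity) (Finset.single_le_sum (f := fun x => b x ^ 2)
      (fun x _ => sq_nonneg (b x)) (Finset.mem_univ x0))
  have hne : 2 * (κ + m2) ≠ 0 := by
    intro h0
    rw [h0, zero_mul] at h
    linarith
  have hq : (∑ x, b x ^ 2) / (2 * (κ + m2)) ≠ 0 := div_ne_zero hpos.ne' hne
  rw [mul_div_assoc, div_self hq, mul_one]

end Shift

/-! ## Integrated autocorrelation times: `z = 2` exactly -/

section Tau

/-- **τ_int of a mode, in sweeps.**  A geometric autocorrelation function `ρ_t = f^t` with
`f = scanFactor d V m² κ ω`, `0 < ω(κ + m²) < 2V(2d + m²)`, has (Madras–Sokal convention,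
`tauInt` of `Scoring/CalibrationTruths.lean`) `τ_int = (1 + f)/(2(1 − f))` updates, i.e.
`τ_int / V = (2d + m²)/(ω(κ + m²)) − 1/(2V)` SWEEPS of `V` updates. -/
theorem tauInt_scanFactor_div (d V : ℕ) (m2 κ ω : ℝ) (hV : 0 < V) (hD : 0 < 2 * (d : ℝ) + m2)
    (hc : 0 < ω * (κ + m2)) (hc2 : ω * (κ + m2) < 2 * V * (2 * d + m2)) :
    tauInt (fun t => scanFactor d V m2 κ ω ^ t) / V
      = (2 * d + m2) / (ω * (κ + m2)) - 1 / (2 * V) := by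
  have hVr : (0 : ℝ) < V := Nat.cast_pos.mpr hV
  have hVD : 0 < (V : ℝ) * (2 * d + m2) := mul_pos hVr hD
  set c := ω * (κ + m2) / (V * (2 * d + m2)) with hc_def
  have hc0 : 0 < c := div_pos hc hVD
  have hc1 : c < 2 := by
    rw [hc_def, div_lt_iff₀ hVD]
    linarith
  have hf : scanFactor d V m2 κ ω = 1 - c := rfl
  have habs : |scanFactor d V m2 κ ω| < 1 := by
    rw [hf, abs_lt]
    constructor <;> linarith
  rw [tauInt_geometric habs, hf]
  have hω0 : ω ≠ 0 := by
    rintro rfl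
    simp at hc
  have hκ : κ + m2 ≠ 0 := by
    intro h0
    rw [h0, mul_zero] at hc
    exact lt_irrefl _ hc
  rw [hc_def]
  field_simp
  ring

/-- **Heat bath (`ω = 1`), any mode `0 ≤ κ ≤ 4d`** (the whole spectrum of `−Δ_lat`), `m² > 0`:
`τ_int(O_κ) / V = (2d + m²)/(κ + m²) − 1/(2V)` sweeps. -/
theorem tauInt_heatBath_mode (d V : ℕ) (m2 κ : ℝ) (hV : 0 < V) (hm2 : 0 < m2) (hκ0 : 0 ≤ κ)
    (hκ : κ ≤ 4 * d) :
    tauInt (fun t => scanFactor d V m2 κ 1 ^ t) / V = (2 * d + m2) / (κ + m2) - 1 / (2 * V) := by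
  have hD : 0 < 2 * (d : ℝ) + m2 := by positivity
  have hVr : (1 : ℝ) ≤ V := by exact_mod_cast hV
  have h := tauInt_scanFactor_div d V m2 κ 1 hV hD (by rw [one_mul]; positivity)
    (by
      rw [one_mul]
      have hd0 : (0 : ℝ) ≤ d := Nat.cast_nonneg d
      nlinarith)
  rw [one_mul] at h
  exact h

/-- **`z = 2` exactly for the magnetisation.**  Under the random-scan heat bath of the free field
(`m² > 0`, `V` sites, `d` directions) the slowest linear observable, `M = Σ_x φ_x` (`κ = 0`), has
`τ_int(M) / V = 2d · (1/m²) + 1 − 1/(2V)` sweeps: with the free field's second-moment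
correlation length `ξ₂² = 1/m²` (`xi2_free`), `τ_int,sweeps = 2d ξ₂² + 1 − 1/(2V)` at EVERY volume —
dynamical exponent `z = 2` with amplitude `2d`, no corrections to scaling beyond the constants. -/
theorem tauInt_heatBath_magnetisation (d V : ℕ) (m2 : ℝ) (hV : 0 < V) (hm2 : 0 < m2) :
    tauInt (fun t => scanFactor d V m2 0 1 ^ t) / V = 2 * d * (1 / m2) + 1 - 1 / (2 * V) := by
  rw [tauInt_heatBath_mode d V m2 0 hV hm2 le_rfl (by positivity), zero_add]
  field_simp

/-- **Over-relaxation only rescales**: at fixed `ω ∈ (0, 2)` (and `V ≥ 1`, `m² > 0`) the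
magnetisation has `τ_int / V = (2d + m²)/(ω m²) − 1/(2V)` — still `z = 2`; Adler–Neuberger's
`z → 1` needs the ORDERED sweep with `2 − ω ∝ m`, not treated here. -/
theorem tauInt_overrelaxed_magnetisation (d V : ℕ) (m2 ω : ℝ) (hV : 0 < V) (hm2 : 0 < m2)
    (hω0 : 0 < ω) (hω2 : ω < 2) :
    tauInt (fun t => scanFactor d V m2 0 ω ^ t) / V = (2 * d + m2) / (ω * m2) - 1 / (2 * V) := by
  have hD : 0 < 2 * (d : ℝ) + m2 := by positivity
  have hVr : (1 : ℝ) ≤ V := by exact_mod_cast hV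
  have h := tauInt_scanFactor_div d V m2 0 ω hV hD (by rw [zero_add]; positivity)
    (by
      rw [zero_add]
      have hd0 : (0 : ℝ) ≤ d := Nat.cast_nonneg d
      nlinarith)
  rw [zero_add] at h
  exact h

/-- The free field's second-moment correlation length from the oracle `G̃(k) = 1/(2(m² + k̂²))`:
`G̃(0)/G̃(k) − 1 = k̂² · (1/m²)`, i.e. `ξ₂² = 1/m²` exactly on the lattice. -/
theorem xi2_free (m2 K : ℝ) (hm2 : 0 < m2) (hK : 0 ≤ K) :
    (1 / (2 * m2)) / (1 / (2 * (m2 + K))) - 1 = K * (1 / m2) := by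
  have : 0 < m2 + K := by positivity
  field_simp
  ring

end Tau

end Summit.Ventures.LatticeQCDFlow.Scoring
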